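import Summits.BirchSwinnertonDyer.BirchSwinnertonDyer.Theorems.KolyvaginRankRigidityAtTwoSwapFromPiecesCore
import Summits.BirchSwinnertonDyer.BirchSwinnertonDyer.Theorems.KolyvaginRankRigidityAtTwoKolyvaginCorankLowerBoundAtTwoMarginChebotarevOneClassIndexAtTwo
import Summits.BirchSwinnertonDyer.BirchSwinnertonDyer.Theorems.KolyvaginRankRigidityAtTwoKolyvaginCorankLowerBoundAtTwoSelmerAwayFromConductor
import Literature.NumberTheory.Sieve.FriedlanderIwaniecPrimesSquarefreeProofs
import HarnessLib

/-!
# Crux V2♭θ / V2♭∞ (stmt-BirchSwinnertonDyer-27220; line `kolyvagin_depth_split`), stub S1 — the prime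
# swap at 2 from its pieces, III: the registered shape

`primeSwapAtTwoLossy_of_pieces`: the registered S1L text (lossy swap: test clause and output exponent
`j − c₂`; Finset currency `T ↦ insert ℓ (T.erase a)`) for a fixed frame, Weil data, Poitou–Tate families and
transverse structures, from the hypotheses P4, P5, P7a, P7b, P8, Q2 (see `…SwapFromPiecesCore`) and the
landed T2 / S2 (which supply `t`, `c₁`): `c₀ = 2 (c₁ + c₅ + c₇ + c₇' + t + 8)`, `c₂ = c₁ + c₇ + c₇' + 4`.
HONEST FRAMING: a composition modulo the hypotheses listed; nothing here proves S1, V2♭θ or BSD.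
-/

set_option autoImplicit false
set_option linter.dupNamespace false

noncomputable section

open scoped Classical Pointwise
open Function NumberField IsDedekindDomain WeierstrassCurve Field
open Literature.NumberTheory.EllipticCurves Literature.NumberTheory.GaloisRepresentations
open Literature.NumberTheory.EllipticCurves.Jetchev2008 Literature.NumberTheory.EllipticCurves.ModularForms
open Literature.NumberTheory.GaloisCohomology
open Literature.NumberTheory.GaloisRepresentations.DiscreteGaloisModule (localTatePairingZMod
  tateDual SelmerStructure)
open Summit.BirchSwinnertonDyer.Rank1Residual.JET.SelmerVocabulary
open Summit.BirchSwinnertonDyer.Rank1Residual.JET.GlobalDuality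
open Summit.BirchSwinnertonDyer.BirchSwinnertonDyer.Theses.KolyvaginRankRigidityAtTwo
open Summit.BirchSwinnertonDyer.BirchSwinnertonDyer.Theses.GenusKolyvaginAtTwo (KolyvaginRelationAtTwo)

namespace Summit.BirchSwinnertonDyer.BirchSwinnertonDyer.Theorems.KolyvaginLowerBoundAtTwo

/-- Removing one prime from a product of distinct primes. [folklore] -/
private theorem prod_primes_div_swap {s : Finset ℕ} (hs : ∀ p ∈ s, p.Prime) {ℓ : ℕ} (hℓ : ℓ ∈ s) :
    (∏ p ∈ s, p) / ℓ = ∏ p ∈ s.erase ℓ, p := by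
  refine Nat.div_eq_of_eq_mul_right (hs ℓ hℓ).pos ?_
  rw [Finset.mul_prod_erase s (fun p ↦ p) hℓ]

section Frame

variable {K : Type} [Field K] [NumberField K] (W : WeierstrassCurve ℚ) [W.IsElliptic]
  [W.IsGloballyMinimal] [(W.baseChange K).IsElliptic] [NeZero (W.conductorNorm ℤ)]
  [∀ M : ℕ, NeZero (2 ^ M)] [∀ M : ℕ, Finite (geomTorsion (W.baseChange K) ((2 ^ M : ℕ) : ℤ))]
  (τ : K ≃ₐ[ℚ] K)
  (Dt : ModularParametrizationData W (W.conductorNorm ℤ)) (β : ℤ) (ι : K →+* ℂ)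
  -- the Weil data, one per level
  (e : ∀ M : ℕ, geomTorsion (W.baseChange K) ((2 ^ M : ℕ) : ℤ) →
    geomTorsion (W.baseChange K) ((2 ^ M : ℕ) : ℤ) → AlgebraicClosure K)
  (hμ : ∀ M S T, e M S T ^ (2 ^ M) = 1)
  (hadd₁ : ∀ M S₁ S₂ T, e M (S₁ + S₂) T = e M S₁ T * e M S₂ T)
  (hadd₂ : ∀ M S T₁ T₂, e M S (T₁ + T₂) = e M S T₁ * e M S T₂)
  (hgal : ∀ M (g : absoluteGaloisGroup K) (S T : geomTorsion (W.baseChange K) ((2 ^ M : ℕ) : ℤ)),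
    g • e M S T = e M (g • S) (g • T))
  (halt : ∀ M T, e M T T = 1) (hnondeg : ∀ M T, (∀ S, e M S T = 1) → T = 0)
  -- the Poitou–Tate families, one per level
  (inv : ∀ M : ℕ, LocalInvariants K (2 ^ M))
  -- the transverse structures, one per level (independent of the conductor, as in `Swap.not_dvd_of_swap`)
  (𝒯 : ∀ M : ℕ, SelmerStructure ((W.baseChange K).torsionGaloisModule ((2 ^ M : ℕ) : ℤ)))

  -- the habitat
  (hCM : ¬ W.HasCM) (hred : Rank1Residual.GoodOrd W 2 ∨ Rank1Residual.Mult W 2)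
  (hsur : ∀ m : ℕ, W.HasSurjectiveModNGaloisRep (2 ^ m : ℕ)) (hK : IsImaginaryQuadratic K)
  (hne3 : NumberField.discr K ≠ -3) (hne4 : NumberField.discr K ≠ -4)
  (h2d : ¬ ((2 : ℤ) ∣ NumberField.discr K)) (hHN : SatisfiesHeegnerHypothesis (W.conductorNorm ℤ) K)
  (hτ1 : τ ≠ 1)
  (hperf : ∀ M, (inv M).IsPerfect) (hvan : ∀ M, (inv M).SumLocalTermEqZero)
  -- P8: the transverse package at `2`
  (h𝒯sd : ∀ (M c : ℕ), ∀ v ∈ placesDividing K c,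
    (inv M).dualTransported (𝒯 M) (weilDualIntertwining (W.baseChange K) (2 ^ M) (e M) (hμ M) (hadd₁ M)
      (hadd₂ M) (hgal M)) (Sum.inr v) = 𝒯 M (Sum.inr v))
  -- P4: transversality at the primes of the conductor (margin one)
  (hP4 : ∀ (M c : ℕ) (dat : KolyvaginHeegnerData Dt β ι c),
    KolyvaginDescent.KolSupp (Zhang2014.IsKolyvaginPrime (W.conductorNorm ℤ) W K 2) c → 1 ≤ M →
    (∀ q ∈ c.primeFactors, M + 1 ≤ Zhang2014.kolyvaginIndex W 2 q) →
    ∀ w ∈ placesDividing K c,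
      galoisCohomology.localization ((W.baseChange K).torsionGaloisModule ((2 ^ M : ℕ) : ℤ)) (Sum.inr w) 1
        (dat.kolyvaginClass Nat.prime_two M) ∈ 𝒯 M (Sum.inr w))
  -- P5: auxiliary classes of order ≥ 2^(M/2 - c₅)
  {c₅ : ℕ}
  (hP5 : ∀ (M m a : ℕ) (v₀ : HeightOneSpectrum (𝓞 K)) (s : ℤ), (s = 1 ∨ s = -1) → 1 ≤ M →
    KolyvaginDescent.KolSupp (Zhang2014.IsKolyvaginPrime (W.conductorNorm ℤ) W K 2) m →
    (∀ q ∈ m.primeFactors, M + 1 ≤ Zhang2014.kolyvaginIndex W 2 q) →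
    Zhang2014.IsKolyvaginPrime (W.conductorNorm ℤ) W K 2 a → M + 1 ≤ Zhang2014.kolyvaginIndex W 2 a →
    ¬ a ∣ m → ((a : ℕ) : 𝓞 K) ∈ v₀.asIdeal →
    ∃ w : galoisCohomology ((W.baseChange K).torsionGaloisModule ((2 ^ M : ℕ) : ℤ)) 1,
      w ∈ signPart W K τ ((2 ^ M : ℕ) : ℤ) s
        (((selmerF W ((2 ^ M : ℕ) : ℤ) (𝒯 M) (placesDividing K m)).relaxedAt {v₀}).selmerGroup) ∧
      ((2 ^ (M / 2 - c₅) : ℕ) : ℤ) • w ≠ 0)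
  -- P7a: lower bound of the pairing order at a fresh Kolyvagin prime
  {c₇ : ℕ}
  (hP7a : ∀ (M ℓ : ℕ) (v : HeightOneSpectrum (𝓞 K))
    (w C : galoisCohomology ((W.baseChange K).torsionGaloisModule ((2 ^ M : ℕ) : ℤ)) 1) (s : ℤ) (a b : ℕ),
    (s = 1 ∨ s = -1) → Zhang2014.IsKolyvaginPrime (W.conductorNorm ℤ) W K 2 ℓ →
    M ≤ Zhang2014.kolyvaginIndex W 2 ℓ → ((ℓ : ℕ) : 𝓞 K) ∈ v.asIdeal →
    conjAct W τ ((2 ^ M : ℕ) : ℤ) w = s • w → conjAct W τ ((2 ^ M : ℕ) : ℤ) C = s • C →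
    galoisCohomology.localization ((W.baseChange K).torsionGaloisModule ((2 ^ M : ℕ) : ℤ)) (Sum.inr v) 1 w ∈
      (W.baseChange K).kummerSelmerStructure ((2 ^ M : ℕ) : ℤ) (Sum.inr v) →
    ((2 ^ a : ℕ) : ℤ) • galoisCohomology.localization ((W.baseChange K).torsionGaloisModule ((2 ^ M : ℕ) : ℤ))
      (Sum.inr v) 1 w ≠ 0 →
    ((2 ^ b : ℕ) : ℤ) • galoisCohomology.localization ((W.baseChange K).torsionGaloisModule ((2 ^ M : ℕ) : ℤ))
      (Sum.inr v) 1 C ∉ (W.baseChange K).kummerSelmerStructure ((2 ^ M : ℕ) : ℤ) (Sum.inr v) →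
    M + c₇ ≤ a + b + 1 →
    (2 ^ (a + b + 1 - M - c₇) : ℕ) •
        localTatePairingZMod ((W.baseChange K).torsionGaloisModule ((2 ^ M : ℕ) : ℤ)) (2 ^ M) (Sum.inr v)
          (inv M (Sum.inr v))
          (galoisCohomology.localization ((W.baseChange K).torsionGaloisModule ((2 ^ M : ℕ) : ℤ)) (Sum.inr v) 1 w)
          (galoisCohomology.localization (((W.baseChange K).torsionGaloisModule ((2 ^ M : ℕ) : ℤ)).tateDual (2 ^ M))
            (Sum.inr v) 1
            (galoisCohomology.map (weilDualIntertwining (W.baseChange K) (2 ^ M) (e M) (hμ M) (hadd₁ M) (hadd₂ M)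
              (hgal M)) 1 C)) ≠ 0)
  -- P7b: upper bound of the pairing order at the prime being swapped out
  {c₇' : ℕ}
  (hP7b : ∀ (M q : ℕ) (v : HeightOneSpectrum (𝓞 K))
    (w C : galoisCohomology ((W.baseChange K).torsionGaloisModule ((2 ^ M : ℕ) : ℤ)) 1) (s : ℤ) (a₀ b₀ : ℕ),
    (s = 1 ∨ s = -1) → Zhang2014.IsKolyvaginPrime (W.conductorNorm ℤ) W K 2 q →
    M + 1 ≤ Zhang2014.kolyvaginIndex W 2 q → ((q : ℕ) : 𝓞 K) ∈ v.asIdeal →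
    conjAct W τ ((2 ^ M : ℕ) : ℤ) w = s • w → conjAct W τ ((2 ^ M : ℕ) : ℤ) C = s • C →
    galoisCohomology.localization ((W.baseChange K).torsionGaloisModule ((2 ^ M : ℕ) : ℤ)) (Sum.inr v) 1 C ∈
      𝒯 M (Sum.inr v) →
    ((2 ^ a₀ : ℕ) : ℤ) • galoisCohomology.localization ((W.baseChange K).torsionGaloisModule ((2 ^ M : ℕ) : ℤ))
      (Sum.inr v) 1 w ∈ 𝒯 M (Sum.inr v) →
    ((2 ^ b₀ : ℕ) : ℤ) • galoisCohomology.localization ((W.baseChange K).torsionGaloisModule ((2 ^ M : ℕ) : ℤ))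
      (Sum.inr v) 1 C = 0 →
    (2 ^ (a₀ + b₀ + c₇' - M) : ℕ) •
        localTatePairingZMod ((W.baseChange K).torsionGaloisModule ((2 ^ M : ℕ) : ℤ)) (2 ^ M) (Sum.inr v)
          (inv M (Sum.inr v))
          (galoisCohomology.localization ((W.baseChange K).torsionGaloisModule ((2 ^ M : ℕ) : ℤ)) (Sum.inr v) 1 w)
          (galoisCohomology.localization (((W.baseChange K).torsionGaloisModule ((2 ^ M : ℕ) : ℤ)).tateDual (2 ^ M))
            (Sum.inr v) 1
            (galoisCohomology.map (weilDualIntertwining (W.baseChange K) (2 ^ M) (e M) (hμ M) (hadd₁ M) (hadd₂ M)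
              (hgal M)) 1 C)) = 0)
  -- Q2 by name (landed modulo Gross 1991 Prop. 3.7 (2))
  (hQ2 : KolyvaginRelationAtTwo)

/-! ### The registered shape (stub S1L of the `∞` skeleton; Finset currency) -/

include halt hnondeg hCM hred hsur hK hne3 hne4 h2d hHN hτ1 hperf hvan h𝒯sd hP4 hP5 hP7a hP7b hQ2 in
/-- **The prime swap at `2` (lossy form, S1L) from its pieces**: the registered stub text of the line
`kolyvagin_depth_split` (crux V2♭θ / V2♭∞) for a fixed frame `(Dt, β, ι)`, Weil data `e`, Poitou–Tate
families `inv` and transverse structures `𝒯`, from P4 (`hP4`), P5 (`hP5`), P7 (`hP7a`, `hP7b`), P8 (`h𝒯sd`),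
Q2 BY NAME (`hQ2`) and the landed T2, T3, S2, P1, P6 and pair Čebotarev; constants
`c₀ = 2 (c₁ + c₅ + c₇ + c₇' + t + 8)`, `c₂ = c₁ + c₇ + c₇' + 4` (`t` of T2, `c₁` of S2). HONEST FRAMING: a
composition — P4, P5, P7, P8 are hypotheses here and Q2 is open (landed modulo Gross 1991 Prop. 3.7 (2));
nothing in this file proves S1, V2♭θ or BSD. [cite: Kolyvagin1991MathAnn, §2 Thm. 2.2, p. 257]
[cite: McCallumLMS1991, §5 Prop. 5.2, Lemma 5.3] [cite: WZhang2014, Lemma 8.2, Lemma 8.4] -/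
theorem primeSwapAtTwoLossy_of_pieces :
    ∃ c₀ c₂ : ℕ, ∀ (M I : ℕ) (T : Finset ℕ) (a : ℕ)
      (dat : KolyvaginHeegnerData Dt β ι (∏ p ∈ T, p)) (j : ℕ) (X : Finset ℕ),
      1 ≤ M → M + 1 ≤ I →
      (∀ p ∈ T, Zhang2014.IsKolyvaginPrime (W.conductorNorm ℤ) W K 2 p ∧
        M + 1 ≤ Zhang2014.kolyvaginIndex W 2 p) →
      a ∈ T → M + c₀ ≤ 2 * j →
      (∀ X' : Finset ℕ, ∃ q : ℕ, q ∉ X' ∧ Zhang2014.IsKolyvaginPrime (W.conductorNorm ℤ) W K 2 q ∧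
        I ≤ Zhang2014.kolyvaginIndex W 2 q ∧
        ∃ v : HeightOneSpectrum (𝓞 K), ((q : ℕ) : 𝓞 K) ∈ v.asIdeal ∧
          ((2 ^ j : ℕ) : ℤ) • dat.kolyvaginClass Nat.prime_two M ∉
            (W.baseChange K).torsionLocalKer (v.adicCompletion K) ((2 ^ M : ℕ) : ℤ)) →
      ∃ ℓ : ℕ, ℓ ∉ X ∧ ℓ ∉ T ∧ Zhang2014.IsKolyvaginPrime (W.conductorNorm ℤ) W K 2 ℓ ∧
        I ≤ Zhang2014.kolyvaginIndex W 2 ℓ ∧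
        (∃ v : HeightOneSpectrum (𝓞 K), ((ℓ : ℕ) : 𝓞 K) ∈ v.asIdeal ∧
          ((2 ^ (j - c₂) : ℕ) : ℤ) • dat.kolyvaginClass Nat.prime_two M ∉
            (W.baseChange K).torsionLocalKer (v.adicCompletion K) ((2 ^ M : ℕ) : ℤ)) ∧
        ∃ dat' : KolyvaginHeegnerData Dt β ι (∏ p ∈ insert ℓ (T.erase a), p),
          ∀ X' : Finset ℕ, ∃ q : ℕ, q ∉ X' ∧
            Zhang2014.IsKolyvaginPrime (W.conductorNorm ℤ) W K 2 q ∧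
            I ≤ Zhang2014.kolyvaginIndex W 2 q ∧
            ∃ v : HeightOneSpectrum (𝓞 K), ((q : ℕ) : 𝓞 K) ∈ v.asIdeal ∧
              ((2 ^ (j - c₂) : ℕ) : ℤ) • dat'.kolyvaginClass Nat.prime_two M ∉
                (W.baseChange K).torsionLocalKer (v.adicCompletion K) ((2 ^ M : ℕ) : ℤ) := by
  classical
  obtain ⟨t, hT2⟩ := KolyvaginRankRigidity.stub_selmerAwayFromConductor W hCM hred hsur K hK hne3 hne4 h2d
    hHN Dt β ι
  obtain ⟨c₁, hS2⟩ := stub_chebotarevOneClassIndexAtTwo W hCM hred hsur K hK hne3 hne4 h2d hHN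
  refine ⟨2 * (c₁ + c₅ + c₇ + c₇' + t + 8), c₁ + c₇ + c₇' + 4, ?_⟩
  intro M I T a dat j X hM hMI hT haT hj hBig
  have hTp : ∀ p ∈ T, p.Prime := fun p hp ↦ (hT p hp).1.1
  have hpf : (∏ p ∈ T, p).primeFactors = T := Nat.primeFactors_prod hTp
  obtain ⟨ℓ, hℓX, hℓT, hKol, hIℓ, hv, dat', hBig'⟩ :=
    primeSwapAtTwoLossy_core (W := W) (τ := τ) (Dt := Dt) (β := β) (ι := ι) (e := e) (hμ := hμ)
      (hadd₁ := hadd₁) (hadd₂ := hadd₂) (hgal := hgal) (halt := halt) (hnondeg := hnondeg) (inv := inv)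
      (𝒯 := 𝒯) (hCM := hCM) (hred := hred) (hsur := hsur) (hK := hK) (hne3 := hne3) (hne4 := hne4)
      (h2d := h2d) (hHN := hHN) (hτ1 := hτ1) (hperf := hperf) (hvan := hvan) (h𝒯sd := h𝒯sd) (hP4 := hP4)
      (hP5 := hP5) (hP7a := hP7a) (hP7b := hP7b) (hQ2 := hQ2) (hT2 := hT2) (hS2 := hS2 Dt β ι) X dat hM
      hMI (Literature.NumberTheory.Sieve.FriedlanderIwaniecPrimesSquarefree.squarefree_prod_of_primes hTp) (by rw [hpf]; exact hT) (by rw [hpf]; exact haT) hj hBig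
  rw [hpf] at hℓT
  have hdiv : (∏ p ∈ T, p) / a * ℓ = ∏ p ∈ insert ℓ (T.erase a), p := by
    rw [prod_primes_div_swap hTp haT, Finset.prod_insert (fun h ↦ hℓT (Finset.mem_of_mem_erase h)), mul_comm]
  refine ⟨ℓ, hℓX, hℓT, hKol, hIℓ, hv, hdiv ▸ dat', fun X' ↦ ?_⟩
  obtain ⟨q, hqX, hKq, hIq, v, hvq, hloc⟩ := hBig' X'
  exact ⟨q, hqX, hKq, hIq, v, hvq, by rw [kolyvaginClass_cast_swap]; exact hloc⟩

end Frame

end Summit.BirchSwinnertonDyer.BirchSwinnertonDyer.Theorems.KolyvaginLowerBoundAtTwo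

end
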